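import Literature.AlgebraicGeometry.ShimuraVarieties.UnitaryBallAutomorphicForms
import Literature.Geometry.ComplexHyperbolic.UnitBallBounds

/-!
# Cauchy–Riemann on the complex 2-ball in exponential `𝔭`-coordinates (`U(2,1)`, cotangent weight)

[folklore] The classical criterion "a weight form is holomorphic iff its lift to the group is killed by
`𝔭₋`" (for `SL₂(ℝ)`: Bump, *Automorphic Forms and Representations* (1997) §3.2, around (2.13):
"the lowering operator annihilates `y^{k/2} f`, and this is equivalent to the Cauchy–Riemann
equations"), here for `U(2,1)` acting on the unit ball `𝔹² ⊂ ℂ²` and the vector-valued COTANGENT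
weight `cotangentCocycle g z = (Jac g z)ᵀ` of `UnitaryBallAutomorphicForms`, in the direction that is
needed to PRODUCE holomorphic forms from group-side data:

* `BallForms.mem_holomorphic_of_differentiableAt_expP` — if for every `g ∈ U(2,1)` the function
  `b ↦ f (g · exp X_b)` (`f = toGroupFun cotangentCocycle x₀ F`, `b ∈ ℂ²`) is `ℂ`-differentiable at
  `b = 0`, then `F ∈ holomorphic` (`= DifferentiableOn ℂ (extend F) ballSet`);
* `BallForms.mem_holomorphic_of_cauchyRiemann` — the same with the hypothesis spelled as
  real-differentiability at `0` plus the Cauchy–Riemann relations `L (i b) = i L b` for the real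
  differential (i.e. `X_{ib} f = i · X_b f` for the right derivatives along `𝔭`);
* the infrastructure: `pMat b = X_b ∈ 𝔭` (§1), `exp_mem_U21 : X ∈ 𝔲(2,1) → exp X ∈ U(2,1)`,
  `expU21`, `expP b = exp X_b` (§2, via `NormedSpace.exp`), the orbit map `expOrbit b = exp X_b • x₀`
  with `hasFDerivAt_expOrbit : D(expOrbit)(0) = id_{ℂ²}` and its strict differentiability (inverse
  function theorem input), and the first-order triviality of the automorphy factor along `exp 𝔭`:
  `hasFDerivAt_qAt0_exp : D_b (Jac (exp X_b) x₀)_{ij} |_{b=0} = 0` (§3–§4);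
* `hasFDerivAt_complex_of_real` — a real-differentiable map whose differential commutes with `i` is
  complex-differentiable (§6).

ORIENTATION CONVENTION (to be pinned by the assembler of the theta side). `𝔭 ⊂ 𝔲(2,1) =
{X : Xᴴ J + J X = 0}`, `J = diag(1,1,-1)`, is identified with `ℂ² = T_{x₀} 𝔹²` (`x₀ = 0`) by
`b ↦ X_b := pMat b = [[0, b], [bᴴ, 0]]` with `b` the upper-right COLUMN (`pMat_apply_castSucc_two :
(X_b)_{i2} = b_i`) and `b̄` the lower-left row. With this identification the orbit chart is tangent to
the identity: `hasFDerivAt_expOrbit : HasFDerivAt (b ↦ exp X_b • x₀) (ContinuousLinearMap.id ℂ ℂ²) 0`.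
Consequently "`ℂ`-differentiable at `b = 0`" means `(R(X_b) + i R(X_{ib})) f = 0` for all `b`, i.e.
`f` is annihilated by `𝔭₋ := {X_b + i X_{ib}} = ` the LOWER-LEFT block `{E_{20}, E_{21}}` of
`𝔤𝔩₃(ℂ) = 𝔲(2,1)_ℂ` under the complexified right regular action (and `𝔭₊ =` the upper-right block).
Using the lower-left row `b̄` as the coordinate instead would produce ANTI-holomorphic functions.
The group function convention is the tree's: `toGroupFun A o F g = A g o (F (g • o))`, so
`f h = (Jac h x₀)ᵀ F (h • x₀)` and `F (h • x₀) = coT h x₀ · f h` (`apply_smul_x₀_eq_coT_mulVec`).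

PROOF (of the main theorem). Fix `z₀ = g • x₀`. In the coordinates `b`, `Q b := F ((g exp X_b) • x₀)
= coTOf (JacVec g (expOrbit b) · JacAt0 (exp X_b)) · f (g exp X_b)` is `ℂ`-differentiable at `0`:
`f`-factor by hypothesis, `JacVec g` is holomorphic on the ball, `expOrbit` has `ℂ`-linear
differential `id` at `0`, and `b ↦ JacAt0 (exp X_b)` has differential `0` at `0` (computed along the
one-parameter groups `t ↦ exp (t X_b)`: the entry `(N_{ij}N_{22} - N_{i2}N_{2j})/N_{22}²` has
differential `Y ↦ Y_{ij} - δ_{ij} Y_{22}` at `N = 1`, which vanishes on `𝔭`). By the inverse function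
theorem (`HasStrictFDerivAt.localInverse`, over `ℝ`, the local inverse again having `ℂ`-linear
differential `id`) `extend F ∘ actVec g` agrees near `0` with `Q ∘ ψ`, hence is `ℂ`-differentiable at
`0`; transporting by the biholomorphism `actVec g⁻¹` (`hasFDerivAt_actVec`) gives
`ℂ`-differentiability of `extend F` at `z₀`; `z₀` was arbitrary.

All matrix calculus is done entrywise or along real lines (`HasDerivAt`), which keeps the operator-norm
instances on matrices (`Matrix.Norms.Operator`) out of `ext`/`simp` goals.

NOT HERE: the converse (holomorphic ⇒ killed by `𝔭₋`; not needed to produce forms); the same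
statement for a general cocycle / `canonicalCocycle` (only the cotangent weight is treated); the
junction with `RealMatrixGroup`/`lieDeriv` of `Automorphic.ArchimedeanCalculus` (an instance
`U(2,1)` as a `RealMatrixGroup ℂ (Fin 3)` with `expMem (t • X_b) = expP (t • b)`); smoothness of
theta lifts (the analytic input that verifies the hypothesis is the theta side's).

References: [folklore]. Prototype for `SL₂(ℝ)`: Bump 1997 §3.2 (eqs. (2.12)–(2.14)). Matrix
exponential and `exp (U A U⁻¹) = U exp A U⁻¹`, `(exp A)ᴴ = exp Aᴴ`: Mathlib
`Mathlib.Analysis.Normed.Algebra.MatrixExponential`.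

Provenance. Written under the LEAN-IN-TREE rule for the pub-hodgecm formalisation cell (model-construction
sub-cell, seat mc-autform-2, MODEL-DAG node «W6b-hol», automorphic half): the producer-side input for
the holomorphy binder of weight forms typed over THIS ball model (`BallForms.holWeightForms`). The
cell's package contains an earlier two-directional Cauchy–Riemann file for its own copy of the ball
(frame readings of `C¹` one-forms; same matrices `X_b`, same orientation: `𝔭₋ =` lower-left block);
nothing is imported from it, and nothing in this file is a claim of the manuscripts adjudicated by
that cell.
-/

set_option autoImplicit false

noncomputable section

open scoped Matrix Matrix.Norms.Operator Topology ComplexConjugate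
open MulAction
open Literature.Geometry.ComplexHyperbolic
open Literature.Geometry.ComplexHyperbolic.BallModel
open Literature.NumberTheory.Automorphic.AutomorphyFactor

namespace Literature.AlgebraicGeometry.ShimuraVarieties

namespace BallForms


/-! ### 0. Matrix entries as continuous linear maps; elementary matrices -/

/-- The `(i, j)` entry of a complex matrix, as a continuous `ℂ`-linear map. [folklore] -/
def entryL {m n : Type} [Fintype m] [Fintype n] [DecidableEq m] [DecidableEq n] (i : m) (j : n) :
    Matrix m n ℂ →L[ℂ] ℂ :=
  LinearMap.toContinuousLinearMap (Matrix.entryLinearMap ℂ ℂ i j)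

/-- `entryL i j N = N i j`. [folklore] -/
@[simp] theorem entryL_apply {m n : Type} [Fintype m] [Fintype n] [DecidableEq m] [DecidableEq n]
    (i : m) (j : n) (N : Matrix m n ℂ) : entryL i j N = N i j := rfl

/-- The elementary matrix `E_{ij} ∈ M₂(ℂ)`. [folklore] -/
def unitMat (i j : Fin 2) : Matrix (Fin 2) (Fin 2) ℂ := Matrix.of fun k l => if k = i ∧ l = j then (1 : ℂ) else 0

/-- Entries of the matrix unit `E_{ij}`. [folklore] -/
@[simp] theorem unitMat_apply (i j k l : Fin 2) :
    unitMat i j k l = if k = i ∧ l = j then (1 : ℂ) else 0 := rfl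

/-- A `2 × 2` matrix is the combination of the elementary matrices with its entries. [folklore] -/
theorem sum_smul_unitMat (c : Fin 2 → Fin 2 → ℂ) (k l : Fin 2) :
    (∑ p : Fin 2 × Fin 2, c p.1 p.2 • unitMat p.1 p.2) k l = c k l := by
  simp only [Matrix.sum_apply, Matrix.smul_apply, unitMat_apply, smul_eq_mul, mul_ite, mul_one,
    mul_zero]
  rw [Fintype.sum_prod_type]
  simp only [Fin.sum_univ_two]
  fin_cases k <;> fin_cases l <;> simp

/-! ### 1. The subspace `𝔭 ⊂ 𝔲(2,1)` in coordinates -/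

/-- The matrix `X_b = [[0, b], [bᴴ, 0]] ∈ 𝔲(2,1)` (`b ∈ ℂ²` a column): the standard real
parametrisation of `𝔭` (the `-1`-eigenspace of the Cartan involution `X ↦ -Xᴴ` of `𝔲(2,1)`) by
`ℂ² ≅ T_{x₀} 𝔹²`. [folklore] -/
def pMat (b : (Fin 2 → ℂ)) : Matrix (Fin 3) (Fin 3) ℂ :=
  Matrix.of ![![0, 0, b 0], ![0, 0, b 1], ![conj (b 0), conj (b 1), 0]]

/-- `(X_b)_{02} = b_0`. [folklore] -/
@[simp] theorem pMat_apply_02 (b : (Fin 2 → ℂ)) : pMat b 0 2 = b 0 := rfl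
/-- `(X_b)_{12} = b_1`. [folklore] -/
@[simp] theorem pMat_apply_12 (b : (Fin 2 → ℂ)) : pMat b 1 2 = b 1 := rfl
/-- `(X_b)_{20} = conj b_0`. [folklore] -/
@[simp] theorem pMat_apply_20 (b : (Fin 2 → ℂ)) : pMat b 2 0 = conj (b 0) := rfl
/-- `(X_b)_{21} = conj b_1`. [folklore] -/
@[simp] theorem pMat_apply_21 (b : (Fin 2 → ℂ)) : pMat b 2 1 = conj (b 1) := rfl
/-- `(X_b)_{00} = 0`. [folklore] -/
@[simp] theorem pMat_apply_00 (b : (Fin 2 → ℂ)) : pMat b 0 0 = 0 := rfl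
/-- `(X_b)_{01} = 0`. [folklore] -/
@[simp] theorem pMat_apply_01 (b : (Fin 2 → ℂ)) : pMat b 0 1 = 0 := rfl
/-- `(X_b)_{10} = 0`. [folklore] -/
@[simp] theorem pMat_apply_10 (b : (Fin 2 → ℂ)) : pMat b 1 0 = 0 := rfl
/-- `(X_b)_{11} = 0`. [folklore] -/
@[simp] theorem pMat_apply_11 (b : (Fin 2 → ℂ)) : pMat b 1 1 = 0 := rfl
/-- `(X_b)_{22} = 0`. [folklore] -/
@[simp] theorem pMat_apply_22 (b : (Fin 2 → ℂ)) : pMat b 2 2 = 0 := rfl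

/-- The upper-right block of `X_b` is `b`. [folklore] -/
@[simp] theorem pMat_apply_castSucc_two (b : (Fin 2 → ℂ)) (i : Fin 2) : pMat b (Fin.castSucc i) 2 = b i := by
  fin_cases i <;> rfl

/-- The upper-left block of `X_b` vanishes. [folklore] -/
@[simp] theorem pMat_apply_castSucc_castSucc (b : (Fin 2 → ℂ)) (i j : Fin 2) :
    pMat b (Fin.castSucc i) (Fin.castSucc j) = 0 := by
  fin_cases i <;> fin_cases j <;> rfl

/-- `X_b` is Hermitian. [folklore] -/
theorem conjTranspose_pMat (b : (Fin 2 → ℂ)) : (pMat b)ᴴ = pMat b := by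
  ext i j
  fin_cases i <;> fin_cases j <;> simp [pMat, Matrix.conjTranspose_apply]

/-- `Jᴴ = J` for `J = diag(1,1,-1)`. [folklore] -/
theorem conjTranspose_J : Jᴴ = J := by
  rw [J, Matrix.diagonal_conjTranspose]
  congr 1
  funext i
  fin_cases i <;> simp

/-- `X_b ∈ 𝔲(2,1)`: `X_bᴴ J + J X_b = 0`. [folklore] -/
theorem pMat_skew (b : (Fin 2 → ℂ)) : (pMat b)ᴴ * J + J * pMat b = 0 := by
  rw [conjTranspose_pMat]
  ext i j
  simp only [J, Matrix.add_apply, Matrix.mul_diagonal, Matrix.diagonal_mul, Matrix.zero_apply]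
  fin_cases i <;> fin_cases j <;> simp [pMat]

/-- `b ↦ X_b` is additive. [folklore] -/
theorem pMat_add (b c : (Fin 2 → ℂ)) : pMat (b + c) = pMat b + pMat c := by
  ext i j
  fin_cases i <;> fin_cases j <;> simp [pMat]

/-- `b ↦ X_b` commutes with REAL scalars (it is conjugate-linear in the lower block). [folklore] -/
theorem pMat_smul (r : ℝ) (b : (Fin 2 → ℂ)) : pMat (r • b) = r • pMat b := by
  ext i j
  fin_cases i <;> fin_cases j <;> simp [pMat, Matrix.smul_apply]

/-- `b ↦ X_b` as a continuous `ℝ`-linear map `ℂ² → 𝔤𝔩₃(ℂ)`. [folklore] -/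
def pMatL : (Fin 2 → ℂ) →L[ℝ] Matrix (Fin 3) (Fin 3) ℂ :=
  LinearMap.toContinuousLinearMap
    { toFun := pMat
      map_add' := pMat_add
      map_smul' := fun r b => pMat_smul r b }

/-- `pMatL b = X_b`. [folklore] -/
@[simp] theorem pMatL_apply (b : (Fin 2 → ℂ)) : pMatL b = pMat b := rfl

/-- `X_0 = 0`. [folklore] -/
@[simp] theorem pMat_zero : pMat 0 = 0 := by
  simpa using pMat_smul 0 0

/-! ### 2. One-parameter subgroups: `exp` of `𝔲(2,1)` lies in `U(2,1)` -/

/-- For `X ∈ 𝔲(2,1)` (`Xᴴ J + J X = 0`) the exponential `exp X` preserves `J`: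
`(exp X)ᴴ J (exp X) = J` (since `(exp X)ᴴ = exp Xᴴ = exp (-J X J) = J exp(-X) J`). [folklore] -/
theorem exp_mem_U21 {X : Matrix (Fin 3) (Fin 3) ℂ} (hX : Xᴴ * J + J * X = 0) :
    (NormedSpace.exp X)ᴴ * J * NormedSpace.exp X = J := by
  have hJu : IsUnit J := by
    rw [Matrix.isUnit_iff_isUnit_det, det_J]; norm_num
  have hJinv : J⁻¹ = J := Matrix.inv_eq_left_inv J_mul_J
  have hXH : Xᴴ = J * (-X) * J⁻¹ := by
    have h1 : Xᴴ * J = -(J * X) := eq_neg_of_add_eq_zero_left hX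
    calc Xᴴ = Xᴴ * (J * J) := by rw [J_mul_J, Matrix.mul_one]
      _ = (Xᴴ * J) * J := by rw [Matrix.mul_assoc]
      _ = J * (-X) * J⁻¹ := by rw [h1, hJinv, Matrix.mul_neg, Matrix.neg_mul]
  rw [← Matrix.exp_conjTranspose, hXH, Matrix.exp_conj _ _ hJu, hJinv]
  calc J * NormedSpace.exp (-X) * J * J * NormedSpace.exp X
      = J * (NormedSpace.exp (-X) * ((J * J) * NormedSpace.exp X)) := by
        simp only [Matrix.mul_assoc]
    _ = J := by
        rw [J_mul_J, Matrix.one_mul, ← Matrix.exp_add_of_commute _ _ ((Commute.refl X).neg_left),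
          neg_add_cancel, NormedSpace.exp_zero, Matrix.mul_one]

/-- **`exp : 𝔲(2,1) → U(2,1)`**: the exponential of `X ∈ 𝔲(2,1)` as an element of `U(2,1)`.
[folklore] -/
def expU21 (X : Matrix (Fin 3) (Fin 3) ℂ) (hX : Xᴴ * J + J * X = 0) : U21 :=
  mkU21 (NormedSpace.exp X) (exp_mem_U21 hX)

/-- The matrix of `expU21 X hX` is `exp X`. [folklore] -/
@[simp] theorem mat_expU21 (X : Matrix (Fin 3) (Fin 3) ℂ) (hX : Xᴴ * J + J * X = 0) :
    mat (expU21 X hX) = NormedSpace.exp X := rfl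

/-- `mat` is injective. [folklore] -/
theorem mat_injective : Function.Injective (mat : U21 → Matrix (Fin 3) (Fin 3) ℂ) :=
  fun _ _ h => Subtype.ext (Units.ext h)

/-- **Exponential 𝔭-coordinates**: the family `b ↦ exp X_b ∈ U(2,1)`. [folklore] -/
def expP (b : (Fin 2 → ℂ)) : U21 := expU21 (pMat b) (pMat_skew b)

/-- The matrix of `expP b` is `exp X_b`. [folklore] -/
@[simp] theorem mat_expP (b : (Fin 2 → ℂ)) : mat (expP b) = NormedSpace.exp (pMat b) := rfl

/-- `exp X_0 = 1`. [folklore] -/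
@[simp] theorem expP_zero : expP 0 = 1 :=
  mat_injective (by rw [mat_expP, pMat_zero, NormedSpace.exp_zero, mat_one])

/-- Along a real line `exp` is a one-parameter group: `exp X_{(s+t)b} = exp X_{sb} · exp X_{tb}`. [folklore] -/
theorem expP_add_smul (s t : ℝ) (b : (Fin 2 → ℂ)) : expP ((s + t) • b) = expP (s • b) * expP (t • b) := by
  apply mat_injective
  rw [mat_mul, mat_expP, mat_expP, mat_expP, add_smul, pMat_add, pMat_smul, pMat_smul]
  exact Matrix.exp_add_of_commute _ _ ((Commute.refl (pMat b)).smul_left s |>.smul_right t)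

/-! ### 3. The orbit of `x₀` and the Jacobian in coordinates -/

/-- Coordinates of `N · x₀` for a matrix `N` (`x₀ = 0`: the last column over its last entry). [folklore] -/
def orbitVec (N : Matrix (Fin 3) (Fin 3) ℂ) : (Fin 2 → ℂ) := fun i => N (Fin.castSucc i) 2 * (N 2 2)⁻¹

/-- `(h • x₀) = orbitVec (mat h)`. [folklore] -/
theorem coe_smul_x₀ (h : U21) : (h • x₀).1 = orbitVec (mat h) := by
  funext i
  rw [smul_val]
  simp [W3_apply, x₀, orbitVec, div_eq_mul_inv]

/-- The orbit of `x₀` in exponential 𝔭-coordinates: `b ↦ exp X_b • x₀ ∈ ℂ²`. [folklore] -/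
def expOrbit (b : (Fin 2 → ℂ)) : (Fin 2 → ℂ) := orbitVec (NormedSpace.exp (pMat b))

/-- `expOrbit b` is the coordinate vector of `exp X_b • x₀`. [folklore] -/
theorem expOrbit_eq (b : (Fin 2 → ℂ)) : expOrbit b = (expP b • x₀).1 := by
  rw [coe_smul_x₀, mat_expP]; rfl

/-- `exp X_0 • x₀ = x₀ = 0`. [folklore] -/
@[simp] theorem expOrbit_zero : expOrbit 0 = 0 := by
  rw [expOrbit_eq, expP_zero, one_smul]; rfl

/-- The Jacobian entry `(i,j)` of `z ↦ h • z` AT `x₀`, as a function of the matrix `N = mat h`: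
`(N_{ij} N_{22} - N_{i2} N_{2j}) / N_{22}²`. [folklore] -/
def qAt0 (i j : Fin 2) (N : Matrix (Fin 3) (Fin 3) ℂ) : ℂ :=
  (N (Fin.castSucc i) (Fin.castSucc j) * N 2 2 - N (Fin.castSucc i) 2 * N 2 (Fin.castSucc j)) /
    (N 2 2 * N 2 2)

/-- `Jac h x₀` as a function of `mat h`. [folklore] -/
def JacAt0 (N : Matrix (Fin 3) (Fin 3) ℂ) : Matrix (Fin 2) (Fin 2) ℂ := ∑ p : Fin 2 × Fin 2, qAt0 p.1 p.2 N • unitMat p.1 p.2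

/-- Entries of `JacAt0 N`. [folklore] -/
theorem JacAt0_apply (N : Matrix (Fin 3) (Fin 3) ℂ) (i j : Fin 2) : JacAt0 N i j = qAt0 i j N :=
  sum_smul_unitMat (fun i j => qAt0 i j N) i j

/-- `Jac h x₀ = JacAt0 (mat h)`. [folklore] -/
theorem Jac_x₀_eq (h : U21) : Jac h x₀ = JacAt0 (mat h) := by
  ext i j
  rw [JacAt0_apply, qAt0, Jac, Matrix.of_apply, pow_two]
  simp [W3_apply, x₀]

/-- The homogeneous coordinates `(g · (y, 1))_k`. [folklore] -/
def homog (g : U21) (y : (Fin 2 → ℂ)) (k : Fin 3) : ℂ := (mat g *ᵥ ![y 0, y 1, 1]) k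

/-- The Jacobian entry `(i,j)` of `z ↦ g • z` as a function of `z ∈ ℂ²`. [folklore] -/
def qVec (g : U21) (i j : Fin 2) (y : (Fin 2 → ℂ)) : ℂ :=
  (mat g (Fin.castSucc i) (Fin.castSucc j) * homog g y 2 -
    homog g y (Fin.castSucc i) * mat g 2 (Fin.castSucc j)) / homog g y 2 ^ 2

/-- `Jac g z` as a function of the coordinates of `z`. [folklore] -/
def JacVec (g : U21) (y : (Fin 2 → ℂ)) : Matrix (Fin 2) (Fin 2) ℂ := ∑ p : Fin 2 × Fin 2, qVec g p.1 p.2 y • unitMat p.1 p.2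

/-- Entries of `JacVec g y`. [folklore] -/
theorem JacVec_apply (g : U21) (y : (Fin 2 → ℂ)) (i j : Fin 2) : JacVec g y i j = qVec g i j y :=
  sum_smul_unitMat (fun i j => qVec g i j y) i j

/-- On the ball the homogeneous coordinates are the tree's `W3 g z`. [folklore] -/
theorem homog_coe (g : U21) (z : Ball) (k : Fin 3) : homog g z.1 k = W3 g z k := by
  rw [homog, W3, lift_eq]

/-- `Jac g z = JacVec g z`. [folklore] -/
theorem Jac_eq_JacVec (g : U21) (z : Ball) : Jac g z = JacVec g z.1 := by
  ext i j
  rw [JacVec_apply, qVec, homog_coe, homog_coe, Jac, Matrix.of_apply]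

/-- The inverse transpose of an invertible `2 × 2` matrix by the adjugate formula. [folklore] -/
def coTOf (P : Matrix (Fin 2) (Fin 2) ℂ) : Matrix (Fin 2) (Fin 2) ℂ :=
  (P 0 0 * P 1 1 - P 0 1 * P 1 0)⁻¹ •
    (P 1 1 • unitMat 0 0 - P 1 0 • unitMat 0 1 - P 0 1 • unitMat 1 0 + P 0 0 • unitMat 1 1)

/-- `coT h z = coTOf (Jac h z)`. [folklore] -/
theorem coT_eq_coTOf (h : U21) (z : Ball) : coT h z = coTOf (Jac h z) := by
  rw [coT, Matrix.det_fin_two, coTOf]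
  congr 1
  ext i j
  fin_cases i <;> fin_cases j <;> simp [Matrix.sub_apply, Matrix.add_apply, Matrix.smul_apply]

/-- The ball function is recovered from the group function by the inverse-transposed Jacobian:
`F (h • x₀) = coT h x₀ · (toGroupFun cotangentCocycle x₀ F) h`. [folklore] -/
theorem apply_smul_x₀_eq_coT_mulVec (F : Ball → (Fin 2 → ℂ)) (h : U21) :
    F (h • x₀) = coT h x₀ *ᵥ toGroupFun cotangentCocycle x₀ F h := by
  rw [toGroupFun_apply, cotangentCocycle_apply, Matrix.mulVec_mulVec, coT_mul_transpose_Jac,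
    Matrix.one_mulVec]

/-! ### 4. Derivatives -/

/-- `b ↦ exp X_b` has derivative `b ↦ X_b` at `0` (over `ℝ`). [folklore] -/
theorem hasFDerivAt_exp_pMat : HasFDerivAt (fun b : (Fin 2 → ℂ) => NormedSpace.exp (pMat b)) pMatL 0 := by
  have h1 : HasFDerivAt (NormedSpace.exp : Matrix (Fin 3) (Fin 3) ℂ → Matrix (Fin 3) (Fin 3) ℂ) (1 : Matrix (Fin 3) (Fin 3) ℂ →L[ℝ] Matrix (Fin 3) (Fin 3) ℂ) (pMatL 0) := by
    rw [pMatL_apply, pMat_zero]; exact hasFDerivAt_exp_zero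
  have h2 : HasFDerivAt (fun b : (Fin 2 → ℂ) => NormedSpace.exp (pMat b)) ((1 : Matrix (Fin 3) (Fin 3) ℂ →L[ℝ] Matrix (Fin 3) (Fin 3) ℂ).comp pMatL) 0 :=
    h1.comp (0 : (Fin 2 → ℂ)) pMatL.hasFDerivAt
  exact h2.congr_fderiv (ContinuousLinearMap.ext fun b => rfl)

/-- The orbit map `N ↦ N · x₀` has derivative `Y ↦ (Y_{02}, Y_{12})` at `N = 1`. [folklore] -/
theorem hasFDerivAt_orbitVec_one :
    HasFDerivAt orbitVec (ContinuousLinearMap.pi fun i : Fin 2 => entryL (m := Fin 3) (n := Fin 3) (Fin.castSucc i) 2)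
      (1 : Matrix (Fin 3) (Fin 3) ℂ) := by
  have key : ∀ i : Fin 2, HasFDerivAt (fun N : Matrix (Fin 3) (Fin 3) ℂ => N (Fin.castSucc i) 2 * (N 2 2)⁻¹)
      (entryL (m := Fin 3) (n := Fin 3) (Fin.castSucc i) 2) (1 : Matrix (Fin 3) (Fin 3) ℂ) := by
    intro i
    have hi : (Fin.castSucc i : Fin 3) ≠ 2 := (Fin.castSucc_lt_last i).ne
    have h22 : entryL (m := Fin 3) (n := Fin 3) 2 2 (1 : Matrix (Fin 3) (Fin 3) ℂ) ≠ 0 := by simp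
    have hd : HasFDerivAt (fun N : Matrix (Fin 3) (Fin 3) ℂ => (entryL (m := Fin 3) (n := Fin 3) 2 2 N)⁻¹)
        ((ContinuousLinearMap.smulRight (1 : ℂ →L[ℂ] ℂ) (-(entryL (m := Fin 3) (n := Fin 3) 2 2 (1 : Matrix (Fin 3) (Fin 3) ℂ) ^ 2)⁻¹)).comp
          (entryL (m := Fin 3) (n := Fin 3) 2 2)) (1 : Matrix (Fin 3) (Fin 3) ℂ) :=
      (hasFDerivAt_inv h22).comp (1 : Matrix (Fin 3) (Fin 3) ℂ) (entryL (m := Fin 3) (n := Fin 3) 2 2).hasFDerivAt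
    have h := (entryL (m := Fin 3) (n := Fin 3) (Fin.castSucc i) 2).hasFDerivAt.mul hd
    refine h.congr_fderiv ?_
    ext N
    simp [Matrix.one_apply_ne hi]
  exact hasFDerivAt_pi.2 key

/-- The orbit of `x₀` in exponential 𝔭-coordinates has derivative the identity at `0`
(as a real derivative, which happens to be `ℂ`-linear). [folklore] -/
theorem hasFDerivAt_expOrbit_real :
    HasFDerivAt expOrbit ((ContinuousLinearMap.id ℂ (Fin 2 → ℂ)).restrictScalars ℝ) 0 := by
  have h1 : HasFDerivAt orbitVec ((ContinuousLinearMap.pi fun i : Fin 2 =>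
      entryL (m := Fin 3) (n := Fin 3) (Fin.castSucc i) 2).restrictScalars ℝ) (NormedSpace.exp (pMat 0)) := by
    rw [pMat_zero, NormedSpace.exp_zero]; exact hasFDerivAt_orbitVec_one.restrictScalars ℝ
  refine (h1.comp (0 : (Fin 2 → ℂ)) hasFDerivAt_exp_pMat).congr_fderiv ?_
  ext b i
  change pMat b (Fin.castSucc i) 2 = b i
  exact pMat_apply_castSucc_two b i

/-- … hence `b ↦ exp X_b • x₀` is `ℂ`-differentiable AT `b = 0` with derivative the identity. [folklore] -/
theorem hasFDerivAt_expOrbit : HasFDerivAt expOrbit (ContinuousLinearMap.id ℂ (Fin 2 → ℂ)) 0 :=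
  hasFDerivAt_of_restrictScalars ℝ hasFDerivAt_expOrbit_real rfl

/-- `N ↦ N · x₀` is smooth near `N = 1`. [folklore] -/
theorem contDiffAt_orbitVec_one : ContDiffAt ℂ 1 orbitVec (1 : Matrix (Fin 3) (Fin 3) ℂ) := by
  have h22 : entryL (m := Fin 3) (n := Fin 3) 2 2 (1 : Matrix (Fin 3) (Fin 3) ℂ) ≠ 0 := by simp
  have key : ∀ i : Fin 2, ContDiffAt ℂ 1 (fun N : Matrix (Fin 3) (Fin 3) ℂ => N (Fin.castSucc i) 2 * (N 2 2)⁻¹) (1 : Matrix (Fin 3) (Fin 3) ℂ) :=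
    fun i => ((entryL (m := Fin 3) (n := Fin 3) (Fin.castSucc i) 2).contDiff.contDiffAt).mul
      (((entryL (m := Fin 3) (n := Fin 3) 2 2).contDiff.contDiffAt).inv h22)
  exact contDiffAt_pi.2 key

/-- `b ↦ exp X_b • x₀` is `C¹` at `0` (over `ℝ`). [folklore] -/
theorem contDiffAt_expOrbit : ContDiffAt ℝ 1 expOrbit 0 := by
  have h1 : ContDiffAt ℝ 1 orbitVec (NormedSpace.exp (pMatL 0)) := by
    rw [pMatL_apply, pMat_zero, NormedSpace.exp_zero]
    exact contDiffAt_orbitVec_one.restrict_scalars ℝ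
  have h2 : ContDiffAt ℝ 1 (NormedSpace.exp : Matrix (Fin 3) (Fin 3) ℂ → Matrix (Fin 3) (Fin 3) ℂ) (pMatL 0) :=
    (NormedSpace.exp_analytic (𝕂 := ℝ) (pMatL 0)).contDiffAt
  exact h1.comp (0 : (Fin 2 → ℂ)) (h2.comp (0 : (Fin 2 → ℂ)) pMatL.contDiff.contDiffAt)

/-- … hence STRICTLY differentiable at `0` with derivative the identity (input to the inverse
function theorem). [folklore] -/
theorem hasStrictFDerivAt_expOrbit :
    HasStrictFDerivAt expOrbit ((ContinuousLinearEquiv.refl ℝ (Fin 2 → ℂ)) : (Fin 2 → ℂ) →L[ℝ] (Fin 2 → ℂ)) 0 := by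
  have h := contDiffAt_expOrbit.hasStrictFDerivAt (by simp)
  rw [hasFDerivAt_expOrbit_real.fderiv] at h
  exact h.congr_fderiv (ContinuousLinearMap.ext fun b => rfl)

/-- Entries of the one-parameter group `t ↦ exp (t X)` have derivative `X_{kl}` at `t = 0`. [folklore] -/
theorem hasDerivAt_exp_smul_apply (X : Matrix (Fin 3) (Fin 3) ℂ) (k l : Fin 3) :
    HasDerivAt (fun t : ℝ => (NormedSpace.exp (t • X)) k l) (X k l) 0 := by
  have hexp : HasDerivAt (fun t : ℝ => NormedSpace.exp (t • X))
      (X * NormedSpace.exp ((0 : ℝ) • X)) 0 :=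
    hasDerivAt_exp_smul_const' X 0
  have h := (((entryL (m := Fin 3) (n := Fin 3) k l).restrictScalars ℝ).hasFDerivAt).comp_hasDerivAt
    (0 : ℝ) hexp
  refine h.congr_deriv ?_
  rw [zero_smul, NormedSpace.exp_zero, mul_one]
  rfl

/-- First-order triviality of the isotropy part: `b ↦ (Jac (exp X_b) x₀)_{ij}` has ZERO derivative at
`b = 0`. (The Jacobian entry `(i,j)` at `N = 1` has differential `Y ↦ Y_{ij} - δ_{ij} Y_{22}`, which
kills `𝔭`; we compute the directional derivatives along the lines `t ↦ t b`, where `exp X_{tb} =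
exp (t X_b)` is a one-parameter group.) [folklore] -/
theorem hasFDerivAt_qAt0_exp (i j : Fin 2) :
    HasFDerivAt (fun b : (Fin 2 → ℂ) => qAt0 i j (NormedSpace.exp (pMat b))) (0 : (Fin 2 → ℂ) →L[ℝ] ℂ) 0 := by
  have hi : (Fin.castSucc i : Fin 3) ≠ 2 := (Fin.castSucc_lt_last i).ne
  have hj : (2 : Fin 3) ≠ Fin.castSucc j := (Fin.castSucc_lt_last j).ne'
  set φ : (Fin 2 → ℂ) → ℂ := fun b => qAt0 i j (NormedSpace.exp (pMat b)) with hφ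
  -- (1) `φ` is real-differentiable at `0`
  have h11 : (1 : Matrix (Fin 3) (Fin 3) ℂ) 2 2 * (1 : Matrix (Fin 3) (Fin 3) ℂ) 2 2 ≠ 0 := by simp
  have hqC : DifferentiableAt ℂ (qAt0 i j) (1 : Matrix (Fin 3) (Fin 3) ℂ) := by
    have he : ∀ k l : Fin 3, DifferentiableAt ℂ (fun N : Matrix (Fin 3) (Fin 3) ℂ => N k l) 1 := fun k l =>
      (entryL (m := Fin 3) (n := Fin 3) k l).differentiableAt
    have hnum : DifferentiableAt ℂ (fun N : Matrix (Fin 3) (Fin 3) ℂ => N (Fin.castSucc i) (Fin.castSucc j) * N 2 2 -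
        N (Fin.castSucc i) 2 * N 2 (Fin.castSucc j)) 1 :=
      ((he _ _).fun_mul (he 2 2)).sub ((he _ 2).fun_mul (he 2 _))
    have hden : DifferentiableAt ℂ (fun N : Matrix (Fin 3) (Fin 3) ℂ => N 2 2 * N 2 2) 1 := (he 2 2).fun_mul (he 2 2)
    have hfun : qAt0 i j = fun N : Matrix (Fin 3) (Fin 3) ℂ => (N (Fin.castSucc i) (Fin.castSucc j) * N 2 2 -
        N (Fin.castSucc i) 2 * N 2 (Fin.castSucc j)) * (N 2 2 * N 2 2)⁻¹ :=
      funext fun N => div_eq_mul_inv _ _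
    rw [hfun]
    exact hnum.fun_mul (hden.inv h11)
  have hq1 : DifferentiableAt ℝ (qAt0 i j) (NormedSpace.exp (pMat 0)) := by
    rw [pMat_zero, NormedSpace.exp_zero]; exact hqC.restrictScalars ℝ
  have hφd : DifferentiableAt ℝ φ 0 := by
    show DifferentiableAt ℝ (qAt0 i j ∘ fun b : (Fin 2 → ℂ) => NormedSpace.exp (pMat b)) 0
    exact hq1.comp (0 : (Fin 2 → ℂ)) hasFDerivAt_exp_pMat.differentiableAt
  -- (2) every directional derivative of `φ` at `0` vanishes
  have hline : ∀ b : (Fin 2 → ℂ), HasDerivAt (fun t : ℝ => φ (t • b)) 0 0 := by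
    intro b
    have he := hasDerivAt_exp_smul_apply (pMat b)
    have hnum := ((he (Fin.castSucc i) (Fin.castSucc j)).fun_mul (he 2 2)).fun_sub
      ((he (Fin.castSucc i) 2).fun_mul (he 2 (Fin.castSucc j)))
    have hden := (he 2 2).fun_mul (he 2 2)
    have h0 : (NormedSpace.exp ((0 : ℝ) • pMat b)) 2 2 * (NormedSpace.exp ((0 : ℝ) • pMat b)) 2 2 ≠ 0 := by
      simp
    have hdiv := hnum.fun_div hden h0
    have hfun : (fun t : ℝ => φ (t • b)) = fun t : ℝ =>
        ((NormedSpace.exp (t • pMat b)) (Fin.castSucc i) (Fin.castSucc j) *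
              (NormedSpace.exp (t • pMat b)) 2 2 -
            (NormedSpace.exp (t • pMat b)) (Fin.castSucc i) 2 *
              (NormedSpace.exp (t • pMat b)) 2 (Fin.castSucc j)) /
          ((NormedSpace.exp (t • pMat b)) 2 2 * (NormedSpace.exp (t • pMat b)) 2 2) := by
      funext t
      simp only [hφ, qAt0, pMat_smul]
    rw [hfun]
    refine hdiv.congr_deriv ?_
    simp [Matrix.one_apply_ne hi, Matrix.one_apply_ne hj]
  -- (3) hence the Fréchet derivative vanishes
  have hz : fderiv ℝ φ 0 = 0 := by
    ext b
    have h1 : HasFDerivAt φ (fderiv ℝ φ 0) ((0 : ℝ) • b) := by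
      rw [zero_smul]; exact hφd.hasFDerivAt
    have h2 : HasDerivAt (φ ∘ fun t : ℝ => id t • b) (fderiv ℝ φ 0 ((1 : ℝ) • b)) 0 :=
      h1.comp_hasDerivAt (0 : ℝ) ((hasDerivAt_id (0 : ℝ)).smul_const b)
    have h3 : HasDerivAt (fun t : ℝ => φ (t • b)) (fderiv ℝ φ 0 b) 0 := by
      rw [one_smul] at h2; exact h2
    simpa using h3.unique (hline b)
  have h := hφd.hasFDerivAt
  rw [hz] at h
  exact h

/-- … and (trivially) the zero map is `ℂ`-linear: `b ↦ (Jac (exp X_b) x₀)_{ij}` is `ℂ`-differentiable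
at `0`. [folklore] -/
theorem hasFDerivAt_qAt0_exp_complex (i j : Fin 2) :
    HasFDerivAt (fun b : (Fin 2 → ℂ) => qAt0 i j (NormedSpace.exp (pMat b))) (0 : (Fin 2 → ℂ) →L[ℂ] ℂ) 0 :=
  hasFDerivAt_of_restrictScalars ℝ (hasFDerivAt_qAt0_exp i j) (by simp)

/-- `b ↦ Jac (exp X_b) x₀` is `ℂ`-differentiable AT `0` (with derivative `0`). [folklore] -/
theorem differentiableAt_JacAt0_exp :
    DifferentiableAt ℂ (fun b : (Fin 2 → ℂ) => JacAt0 (NormedSpace.exp (pMat b))) 0 := by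
  have h : HasFDerivAt (fun b : (Fin 2 → ℂ) => JacAt0 (NormedSpace.exp (pMat b)))
      (∑ p : Fin 2 × Fin 2, (0 : (Fin 2 → ℂ) →L[ℂ] ℂ).smulRight (unitMat p.1 p.2)) 0 :=
    HasFDerivAt.fun_sum fun (p : Fin 2 × Fin 2) _ =>
      (hasFDerivAt_qAt0_exp_complex p.1 p.2).smul_const (unitMat p.1 p.2)
  exact h.differentiableAt

/-- `z ↦ Jac g z` (in coordinates) is `ℂ`-differentiable at points of the ball. [folklore] -/
theorem differentiableAt_JacVec (g : U21) (z : Ball) : DifferentiableAt ℂ (JacVec g) z.1 := by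
  have hw : ∀ k, DifferentiableAt ℂ (fun y => homog g y k) z.1 := fun k =>
    (hasFDerivAt_homog g k z.1).differentiableAt
  have h2 : homog g z.1 2 ≠ 0 := by rw [homog_coe]; exact W3_2_ne_zero g z
  have hq : ∀ i j : Fin 2, DifferentiableAt ℂ (qVec g i j) z.1 := by
    intro i j
    have hnum : DifferentiableAt ℂ (fun y => mat g (Fin.castSucc i) (Fin.castSucc j) * homog g y 2 -
        homog g y (Fin.castSucc i) * mat g 2 (Fin.castSucc j)) z.1 :=
      ((hw 2).const_mul _).sub ((hw _).mul_const _)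
    have hden : DifferentiableAt ℂ (fun y => homog g y 2 ^ 2) z.1 := (hw 2).fun_pow 2
    have hfun : qVec g i j = fun y => (mat g (Fin.castSucc i) (Fin.castSucc j) * homog g y 2 -
        homog g y (Fin.castSucc i) * mat g 2 (Fin.castSucc j)) * (homog g y 2 ^ 2)⁻¹ :=
      funext fun y => div_eq_mul_inv _ _
    rw [hfun]
    exact hnum.mul (hden.inv (pow_ne_zero 2 h2))
  have h : DifferentiableAt ℂ
      (fun y => ∑ p : Fin 2 × Fin 2, qVec g p.1 p.2 y • unitMat p.1 p.2) z.1 :=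
    DifferentiableAt.fun_sum fun (p : Fin 2 × Fin 2) _ => (hq p.1 p.2).smul_const (unitMat p.1 p.2)
  exact h

/-- `coTOf` is `ℂ`-differentiable at invertible matrices. [folklore] -/
theorem differentiableAt_coTOf (P : Matrix (Fin 2) (Fin 2) ℂ) (hP : P 0 0 * P 1 1 - P 0 1 * P 1 0 ≠ 0) :
    DifferentiableAt ℂ coTOf P := by
  have he : ∀ i j : Fin 2, DifferentiableAt ℂ (fun Q : Matrix (Fin 2) (Fin 2) ℂ => Q i j) P := fun i j =>
    (entryL i j).differentiableAt
  have h1 : DifferentiableAt ℂ (fun Q : Matrix (Fin 2) (Fin 2) ℂ => (Q 0 0 * Q 1 1 - Q 0 1 * Q 1 0)⁻¹) P :=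
    (((he 0 0).mul (he 1 1)).sub ((he 0 1).mul (he 1 0))).inv hP
  have h2 : DifferentiableAt ℂ (fun Q : Matrix (Fin 2) (Fin 2) ℂ =>
      Q 1 1 • unitMat 0 0 - Q 1 0 • unitMat 0 1 - Q 0 1 • unitMat 1 0 + Q 0 0 • unitMat 1 1) P :=
    ((((he 1 1).smul_const _).sub ((he 1 0).smul_const _)).sub ((he 0 1).smul_const _)).add
      ((he 0 0).smul_const _)
  exact h1.smul h2

/-- Matrix-times-vector of differentiable functions is differentiable. [folklore] -/
theorem differentiableAt_mulVec {C : (Fin 2 → ℂ) → Matrix (Fin 2) (Fin 2) ℂ} {G : (Fin 2 → ℂ) → (Fin 2 → ℂ)} {b : (Fin 2 → ℂ)}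
    (hC : DifferentiableAt ℂ C b) (hG : DifferentiableAt ℂ G b) :
    DifferentiableAt ℂ (fun y => C y *ᵥ G y) b := by
  have hcomp : ∀ i : Fin 2, DifferentiableAt ℂ (fun y => ∑ j : Fin 2, C y i j * G y j) b := by
    intro i
    refine DifferentiableAt.fun_sum fun (j : Fin 2) _ => ?_
    have h1 : DifferentiableAt ℂ (fun y => C y i j) b := (entryL i j).differentiableAt.comp b hC
    have h2 : DifferentiableAt ℂ (fun y => G y j) b :=
      ((ContinuousLinearMap.proj (R := ℂ) (φ := fun _ : Fin 2 => ℂ) j).differentiableAt).comp b hG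
    exact h1.mul h2
  have h : DifferentiableAt ℂ (fun y i => ∑ j, C y i j * G y j) b := differentiableAt_pi.2 hcomp
  have hfun : (fun y => C y *ᵥ G y) = fun y i => ∑ j, C y i j * G y j := by
    funext y i
    simp [Matrix.mulVec, dotProduct]
  rw [hfun]
  exact h

/-! ### 5. The Cauchy–Riemann criterion -/

/-- **Cauchy–Riemann on the ball, cotangent weight.** Let `F : 𝔹² → ℂ²` and let
`f = toGroupFun cotangentCocycle x₀ F : U(2,1) → ℂ²` be its group function
(`f h = (Jac h x₀)ᵀ F(h • x₀)`). If for every `g ∈ U(2,1)` the function `b ↦ f (g · exp X_b)` of the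
exponential `𝔭`-coordinate `b ∈ ℂ²` is `ℂ`-differentiable AT `b = 0` — i.e. real-differentiable there
with `ℂ`-linear differential: the right derivatives of `f` along `𝔭` satisfy the Cauchy–Riemann
relations `X_{ib} f = i · X_b f` ("`f` is annihilated by `𝔭₋`") — then `F` is holomorphic on the ball.
[folklore] -/
theorem mem_holomorphic_of_differentiableAt_expP (F : Ball → (Fin 2 → ℂ))
    (hF : ∀ g : U21, DifferentiableAt ℂ (fun b : (Fin 2 → ℂ) => toGroupFun cotangentCocycle x₀ F (g * expP b)) 0) :
    F ∈ holomorphic (Fin 2 → ℂ) := by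
  rw [mem_holomorphic_iff]
  intro y hy
  -- the point `z₀ = g • x₀`
  set z₀ : Ball := ⟨y, hy⟩
  obtain ⟨g, hg⟩ := exists_smul_x₀_eq z₀
  suffices h : DifferentiableAt ℂ (extend (Fin 2 → ℂ) F) y from h.differentiableWithinAt
  -- (a) `Q b := F ((g · exp X_b) • x₀)` is `ℂ`-differentiable at `0`
  set Q : (Fin 2 → ℂ) → (Fin 2 → ℂ) := fun b => F ((g * expP b) • x₀) with hQ
  have hQd : DifferentiableAt ℂ Q 0 := by
    have hQ' : Q = fun b => coTOf (JacVec g (expOrbit b) * JacAt0 (NormedSpace.exp (pMat b))) *ᵥ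
        toGroupFun cotangentCocycle x₀ F (g * expP b) := by
      funext b
      show F ((g * expP b) • x₀) = _
      rw [apply_smul_x₀_eq_coT_mulVec F (g * expP b), coT_eq_coTOf, Jac_mul, Jac_eq_JacVec, Jac_x₀_eq,
        mat_expP, ← expOrbit_eq]
    rw [hQ']
    refine differentiableAt_mulVec ?_ (hF g)
    refine DifferentiableAt.comp (0 : (Fin 2 → ℂ)) (?_ : DifferentiableAt ℂ coTOf _) ?_
    · -- `coTOf` at `Jac g x₀`
      have h0 : JacVec g (expOrbit 0) * JacAt0 (NormedSpace.exp (pMat 0)) = Jac g x₀ := by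
        rw [expOrbit_zero, pMat_zero, NormedSpace.exp_zero, ← mat_one, ← Jac_x₀_eq, BallModel.Jac_one,
          Matrix.mul_one, Jac_eq_JacVec]; rfl
      rw [h0]
      apply differentiableAt_coTOf
      rw [← Matrix.det_fin_two]
      exact det_Jac_ne_zero g x₀
    · refine DifferentiableAt.mul ?_ differentiableAt_JacAt0_exp
      have hJ : DifferentiableAt ℂ (JacVec g) (expOrbit 0) := by
        rw [expOrbit_zero]; exact differentiableAt_JacVec g x₀
      exact hJ.comp (0 : (Fin 2 → ℂ)) hasFDerivAt_expOrbit.differentiableAt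
  -- (b) the local inverse `ψ` of `b ↦ exp X_b • x₀` at `0`
  set ψ := hasStrictFDerivAt_expOrbit.localInverse expOrbit (ContinuousLinearEquiv.refl ℝ (Fin 2 → ℂ)) 0 with hψ
  have hψ0 : ψ 0 = 0 := by
    have := hasStrictFDerivAt_expOrbit.localInverse_apply_image
    rw [expOrbit_zero] at this
    exact this
  have hψd : DifferentiableAt ℂ ψ 0 := by
    have h1 : HasFDerivAt ψ ((ContinuousLinearEquiv.refl ℝ (Fin 2 → ℂ)).symm : (Fin 2 → ℂ) →L[ℝ] (Fin 2 → ℂ)) 0 := by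
      have := (hasStrictFDerivAt_expOrbit.to_localInverse).hasFDerivAt
      rw [expOrbit_zero] at this
      exact this
    exact (hasFDerivAt_of_restrictScalars ℝ (f' := ContinuousLinearMap.id ℂ (Fin 2 → ℂ)) h1
      (ContinuousLinearMap.ext fun b => rfl)).differentiableAt
  have hright : ∀ᶠ w in 𝓝 (0 : (Fin 2 → ℂ)), expOrbit (ψ w) = w := by
    have := hasStrictFDerivAt_expOrbit.eventually_right_inverse
    rw [expOrbit_zero] at this
    exact this
  -- (c) `Φ := extend F ∘ actVec g` agrees with `Q ∘ ψ` near `0`, hence is `ℂ`-differentiable at `0`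
  set Φ : (Fin 2 → ℂ) → (Fin 2 → ℂ) := fun w => extend (Fin 2 → ℂ) F (actVec g w) with hΦ
  have hΦQ : ∀ b, Φ (expOrbit b) = Q b := by
    intro b
    show extend (Fin 2 → ℂ) F (actVec g (expOrbit b)) = F ((g * expP b) • x₀)
    rw [expOrbit_eq, actVec_eq, extend_apply_coe, mul_smul]
  have hΦd : DifferentiableAt ℂ Φ 0 := by
    have hev : Φ =ᶠ[𝓝 0] Q ∘ ψ :=
      hright.mono fun w hw => by rw [Function.comp_apply, ← hΦQ, hw]
    refine (hev.differentiableAt_iff).2 ?_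
    exact DifferentiableAt.comp (0 : (Fin 2 → ℂ)) (by rw [hψ0]; exact hQd) hψd
  -- (d) `extend F = Φ ∘ actVec g⁻¹` near `y = z₀`, and `actVec g⁻¹` is holomorphic with `z₀ ↦ 0`
  have hginv : g⁻¹ • z₀ = x₀ := by rw [← hg, inv_smul_smul]
  have hev : extend (Fin 2 → ℂ) F =ᶠ[𝓝 y] Φ ∘ actVec g⁻¹ := by
    filter_upwards [isOpen_ballSet.mem_nhds hy] with w hw
    set w' : Ball := ⟨w, hw⟩
    show extend (Fin 2 → ℂ) F w'.1 = extend (Fin 2 → ℂ) F (actVec g (actVec g⁻¹ w'.1))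
    rw [actVec_eq, actVec_eq, smul_inv_smul]
  refine (hev.differentiableAt_iff).2 (DifferentiableAt.comp y ?_ ?_)
  · have : actVec g⁻¹ y = 0 := by
      rw [show y = z₀.1 from rfl, actVec_eq, hginv]; rfl
    rw [this]; exact hΦd
  · exact (hasFDerivAt_actVec g⁻¹ z₀).differentiableAt

/-! ### 6. The Cauchy–Riemann relations proper -/

/-- A real-differentiable map between complex normed spaces whose real derivative commutes with
`i` is complex-differentiable (with the same derivative, now read as a `ℂ`-linear map). [folklore] -/
theorem hasFDerivAt_complex_of_real {E F : Type*} [NormedAddCommGroup E] [NormedSpace ℂ E]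
    [NormedSpace ℝ E] [IsScalarTower ℝ ℂ E] [NormedAddCommGroup F] [NormedSpace ℂ F] [NormedSpace ℝ F]
    [IsScalarTower ℝ ℂ F] {Φ : E → F} {x : E} {L : E →L[ℝ] F} (hΦ : HasFDerivAt Φ L x)
    (hI : ∀ v, L (Complex.I • v) = Complex.I • L v) :
    ∃ L' : E →L[ℂ] F, L'.restrictScalars ℝ = L ∧ HasFDerivAt Φ L' x := by
  have hE : ∀ (r : ℝ) (w : E), (r : ℂ) • w = r • w := fun r w => by
    rw [← Complex.coe_algebraMap]; exact algebraMap_smul ℂ r w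
  have hF : ∀ (r : ℝ) (w : F), (r : ℂ) • w = r • w := fun r w => by
    rw [← Complex.coe_algebraMap]; exact algebraMap_smul ℂ r w
  have key : ∀ (c : ℂ) (v : E), L (c • v) = c • L v := by
    intro c v
    calc L (c • v) = L ((c.re : ℂ) • v + ((c.im : ℂ) * Complex.I) • v) := by
            rw [← add_smul, Complex.re_add_im]
      _ = L ((c.re : ℝ) • v + (c.im : ℝ) • (Complex.I • v)) := by rw [mul_smul, hE, hE]
      _ = (c.re : ℝ) • L v + (c.im : ℝ) • L (Complex.I • v) := by
            rw [L.map_add, L.map_smul, L.map_smul]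
      _ = (c.re : ℂ) • L v + ((c.im : ℂ) * Complex.I) • L v := by rw [hI, mul_smul, hF, hF]
      _ = c • L v := by rw [← add_smul, Complex.re_add_im]
  let L' : E →L[ℂ] F :=
    ⟨{ toFun := L, map_add' := L.map_add, map_smul' := key }, L.continuous⟩
  have hL' : L'.restrictScalars ℝ = L := ContinuousLinearMap.ext fun v => rfl
  exact ⟨L', hL', hasFDerivAt_of_restrictScalars ℝ hΦ hL'⟩

/-- **Cauchy–Riemann on the ball, cotangent weight — directional form.** If for every `g` the
function `b ↦ f (g · exp X_b)` (`f` the group function of `F`) is real-differentiable at `b = 0` and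
its differential `L_g` satisfies the Cauchy–Riemann relations `L_g (i b) = i L_g (b)` — in Lie-algebra
terms `X_{ib} f = i X_b f` for the right derivatives along `𝔭`, i.e. `f` is killed by
`𝔭₋ = {X_b + i X_{ib}}` — then `F` is holomorphic. [folklore] -/
theorem mem_holomorphic_of_cauchyRiemann (F : Ball → (Fin 2 → ℂ))
    (hd : ∀ g : U21, DifferentiableAt ℝ (fun b : (Fin 2 → ℂ) => toGroupFun cotangentCocycle x₀ F (g * expP b)) 0)
    (hI : ∀ g : U21, ∀ v : (Fin 2 → ℂ),
      fderiv ℝ (fun b : (Fin 2 → ℂ) => toGroupFun cotangentCocycle x₀ F (g * expP b)) 0 (Complex.I • v) =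
        Complex.I • fderiv ℝ (fun b : (Fin 2 → ℂ) => toGroupFun cotangentCocycle x₀ F (g * expP b)) 0 v) :
    F ∈ holomorphic (Fin 2 → ℂ) := by
  refine mem_holomorphic_of_differentiableAt_expP F fun g => ?_
  obtain ⟨L', -, hL'⟩ := hasFDerivAt_complex_of_real (hd g).hasFDerivAt (hI g)
  exact hL'.differentiableAt

end BallForms

end Literature.AlgebraicGeometry.ShimuraVarieties

end
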